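import Literature.MathematicalPhysics.QuantumManyBody.PeriodicBoseGasLemma24Facts
import HarnessLib

/-!
# Fournais 2020, §2 on bounded states: (2.29), Lemma 2.4, (2.43) and Theorem 2.1 restricted to `L^∞`

Topic `Literature/MathematicalPhysics/QuantumManyBody` (provefact
`Literature.MathematicalPhysics.QuantumManyBody.BoseGas.Fournais2020_condensation`). The reduction of
[Fournais2020, Thm. 1.2] in this topic runs
`Fournais2020_condensation ⇐ (3.17) ⇐ Thm. 2.1 ⇐ (2.43) ⇐ (2.25) + Lemma 2.4 ⇐ (2.28) + (2.29) + (2.42)`,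
and every state it ever feeds into Thm. 2.1 is a slice `Z ↦ Ψ(Z, Y)` of a periodic `C¹` trial state
`Ψ` (`PeriodicTrialState`, `PeriodicBoseGasEq317.lean`), hence a **bounded** function. The named
facts `Fournais2020_thm21`, `Fournais2020_eq243`, `Fournais2020_lemma24` are vendored for *all*
measurable `Φ` on `Λ(u)ⁿ` with finite forms (norm, repulsion, kinetic form). For the pairing identity
(2.29) the class of states is not innocent: `⟨Φ, A₂Φ⟩` (`a2Form`) is the Bochner integral of
`conj(PᵢPⱼΦ)·w₁(xᵢ,xⱼ)·QⱼQᵢΦ` with `w₁ ∈ L¹` only (`v ∈ L¹`, Assumption 1.1); it is absolutely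
convergent on the form domain of the box Hamiltonian (finite repulsion — the generality in which the
paper uses (2.29), proved as `Fournais2020_eq229_of_rep`, `PeriodicBoseGasEq229.lean`) and for bounded
`Φ`, whereas for an unbounded `Φ` of finite kinetic energy alone it would be the `-Δ`-form-boundedness
of `W₁ ≤ Cg`, `g = 2(-Δ)ω` (a Hardy-type inequality neither printed nor in the tree; no named fact is
kept for that reading). This file records the four statements **restricted to bounded states**
(`∃ M, ∀ X, ‖Φ X‖ ≤ M`, inserted after `Measurable Φ`; otherwise verbatim), which is the form in which
they are proved and used in the sibling proof files (`…Eq229Bdd`, `…Lemma24Bdd`, `…Eq243Bdd`,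
`…Thm21Bdd`, `…Eq317Bdd`):

* `Fournais2020_eq229_bdd` — [Fournais2020, (2.29)] `⟨Φ, A₂Φ⟩ = ∫Ŵ₁(p)Re⟨b_p†Φ, b_{-p}Φ⟩dp` for bounded `Φ`;
* `Fournais2020_lemma24_bdd` — [Fournais2020, Lemma 2.4 (2.26)] for bounded `Φ`;
* `Fournais2020_eq243_bdd` — [Fournais2020, (2.43)–(2.46)] for bounded `Φ`;
* `Fournais2020_thm21_bdd` — [Fournais2020, Thm. 2.1 (2.11)] on bounded `Φ` of every sector.

The last three are implied by their unrestricted namesakes (`Fournais2020_lemma24.bdd`, …), and the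
printed statements are operator inequalities on the form domain, of which the bounded measurable
functions of finite forms are a core; nothing is weakened relative to the paper beyond the choice of
test states. All four are proved in the sibling files (`Fournais2020_eq229_bdd_holds`, …).

## References

* [Fournais2020] S. Fournais, *Length scales for BEC in the dilute Bose gas*, arXiv:2011.00309,
  EMS Ser. Congr. Rep. 18 (2021), doi:10.4171/ecr/18-1/7: Thm. 2.1 (2.11), Lemma 2.4 (2.26)–(2.29),
  (2.43)–(2.46).
* [BrietzkeFournaisSolovej2020] B. Brietzke, S. Fournais, J. P. Solovej, *A simple 2nd order
  lower bound to the energy of dilute Bose gases*, Comm. Math. Phys. 376 (2020) 323–351: Thm. 6.1.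
* [FournaisSolovej2020] S. Fournais, J. P. Solovej, *The energy of dilute Bose gases*,
  Ann. of Math. 192 (2020) 893–976: Lemma B.2, App. A.
-/

noncomputable section

open MeasureTheory
open scoped ENNReal NNReal FourierTransform ComplexConjugate

namespace Literature.MathematicalPhysics.QuantumManyBody.BoseGas

/-! ### (2.29) on bounded states -/

/-- **Fournais 2020, (2.29), on bounded states.** "A direct calculation gives
`A₂ = ½(2π)⁻³∫Ŵ₁(p)(b_p†b_{-p}† + b_pb_{-p})dp` with `W₁` from (2.8)": for the expectation in a
**bounded** measurable `Φ` on `Λ(u)ⁿ` of finite norm and kinetic form,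
`⟨Φ, A₂Φ⟩ = ∫ Ŵ₁(p) Re⟨b_p†Φ, b_{-p}Φ⟩ dp` with the `p`-integral absolutely convergent (Mathlib's `𝓕`,
`k = 2πp`; hypotheses on `v, ω, χ, C, R, ℓ, s, b` as in `Fournais2020_eq229_of_rep` — `W₁` well
defined: `χ*χ ≥ 1 - C|y|²`, `C(R/ℓ)² ≤ ½`, `supp v ⊂ B̄(0,R)`, `∫v < ∞` — restricted to `Φ ∈ L^∞`, the
class of states met in the reduction of Thm. 1.2). [cite: Fournais2020, (2.29), (2.8), (2.24)] -/
def Fournais2020_eq229_bdd : Prop :=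
  ∀ (v : ℝ → ℝ≥0∞), IsRepulsiveFiniteRange v → (∫⁻ x : Space, v ‖x‖) ≠ ⊤ →
  ∀ (ω : Space → ℝ), IsScatteringSolution v ω →
  ∀ (χ : Space → ℝ), IsLocalizationFunction χ →
  ∀ (C R : ℝ), 0 ≤ C → (∀ y : Space, 1 - C * ‖y‖ ^ 2 ≤ selfConv χ y) → 0 < R → (∀ r, R < r → v r = 0) →
  ∀ (ℓ s b : ℝ), 0 < ℓ → 0 < s → 0 < b → C * (R / ℓ) ^ 2 ≤ 1 / 2 →
  ∀ (n : ℕ) (u : Space) (Φ : Config n → ℂ), Measurable Φ → (∃ M : ℝ, ∀ X, ‖Φ X‖ ≤ M) →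
    (∫⁻ X in boxConfig n ℓ u, ((‖Φ X‖₊ : ℝ≥0∞)) ^ 2) ≠ ⊤ → kinBoxN χ ℓ s b u Φ ≠ ⊤ →
    Integrable (fun p : Space =>
        (𝓕 (fun x : Space => ((bigW₁ v ω χ ℓ x).toReal : ℂ)) p).re * pairingRe χ ℓ u p Φ) ∧
      a2Form v ω χ ℓ u Φ =
        ∫ p : Space, (𝓕 (fun x : Space => ((bigW₁ v ω χ ℓ x).toReal : ℂ)) p).re * pairingRe χ ℓ u p Φ

/-! ### Lemma 2.4 on bounded states -/

/-- **Fournais 2020, Lemma 2.4, on bounded states.** "On the `n`-particle sector,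
`∑ᵢ(T^{(i)} - bℓ⁻²Qᵢ) + A₂ ≥ -(n(n+1)/(2ℓ³))∫gω - Ca((n₀+1)/ℓ³)n₊ - Cnaℓ⁻³(1 + a²(n+1)²/ℓ² + (n+1)R²/ℓ²)`"
(2.26), as the real inequality between the expectations in a symmetric **bounded** measurable `Φ`
on `Λ(u)ⁿ` whose forms are finite — verbatim `Fournais2020_lemma24` (same constants, same weaker
coefficient `(n+1)/ℓ³` for `(n₀+1)/ℓ³`) with the extra hypothesis `∃ M, ∀ X, ‖Φ X‖ ≤ M`.
[cite: Fournais2020, Lemma 2.4 (2.26)–(2.42)] [cite: FournaisSolovej2020, App. A] -/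
def Fournais2020_lemma24_bdd : Prop :=
  ∀ (v : ℝ → ℝ≥0∞), IsRepulsiveFiniteRange v → (∫⁻ x : Space, v ‖x‖) ≠ ⊤ →
    0 < scatteringLength v →
  ∀ (ω : Space → ℝ), IsScatteringSolution v ω →
  ∀ (χ : Space → ℝ), IsLocalizationFunction χ →
  ∀ (s : ℝ), 0 < s →
  ∀ (R : ℝ), 0 < R → (∀ r, R < r → v r = 0) →
  ∃ C c₁ : ℝ, 0 < C ∧ 0 < c₁ ∧
    ∀ (b ℓ : ℝ), 0 < b → 0 < ℓ → R ≤ c₁ * ℓ →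
      let a := (scatteringLength v).toReal
      ∀ (n : ℕ) (u : Space) (Φ : Config n → ℂ), Measurable Φ → (∃ M : ℝ, ∀ X, ‖Φ X‖ ≤ M) →
        (∀ (σ : Equiv.Perm (Fin n)) (X : Config n), Φ (X ∘ σ) = Φ X) →
        (∫⁻ X in boxConfig n ℓ u, (‖Φ X‖₊ : ℝ≥0∞) ^ 2) ≠ ⊤ →
        (∫⁻ X in boxConfig n ℓ u, repBoxN v χ ℓ u X * (‖Φ X‖₊ : ℝ≥0∞) ^ 2) ≠ ⊤ →
        kinBoxN χ ℓ s b u Φ ≠ ⊤ →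
        -((n : ℝ) * (n + 1) / (2 * ℓ ^ 3) * (gOmegaIntegral v ω).toReal *
              (∫⁻ X in boxConfig n ℓ u, (‖Φ X‖₊ : ℝ≥0∞) ^ 2).toReal) -
            C * a * ((n + 1) / ℓ ^ 3) * (nPlusBoxN ℓ u Φ).toReal -
            C * n * a / ℓ ^ 3 * (1 + a ^ 2 * (n + 1) ^ 2 / ℓ ^ 2 + (n + 1) * R ^ 2 / ℓ ^ 2) *
              (∫⁻ X in boxConfig n ℓ u, (‖Φ X‖₊ : ℝ≥0∞) ^ 2).toReal ≤
          (kinBoxN χ ℓ s b u Φ).toReal - b / ℓ ^ 2 * (nPlusBoxN ℓ u Φ).toReal +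
            a2Form v ω χ ℓ u Φ

/-- Lemma 2.4 for all states of finite forms implies Lemma 2.4 on bounded states.
[cite: Fournais2020, Lemma 2.4 (2.26)] -/
theorem Fournais2020_lemma24.bdd (h : Fournais2020_lemma24) : Fournais2020_lemma24_bdd := by
  intro v hv hvi ha ω hω χ hχ s hs R hR0 hR
  obtain ⟨C, c₁, hC, hc₁, H⟩ := h v hv hvi ha ω hω χ hχ s hs R hR0 hR
  refine ⟨C, c₁, hC, hc₁, fun b ℓ hb hℓ hRℓ => ?_⟩
  intro a n u Φ hΦm _ hΦs hN2 hrep hkin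
  exact H b ℓ hb hℓ hRℓ n u Φ hΦm hΦs hN2 hrep hkin

/-! ### (2.43)–(2.46) on bounded states -/

/-- **Fournais 2020, (2.43)–(2.46), on bounded states.** "On the `n`-particle subspace
`(H_Λ(ρ_μ))_n ≥ E_Main + E_gap + E_error`" with `E_Main = -4πaρ_μ²ℓ³ + 2π(a/ℓ³)(ρ_μℓ³ - n)²` (2.44),
`E_gap = (bℓ⁻² - Ca((n+1)/ℓ³ + ρ_μ))n₊` (2.45), `E_error = -Cnaℓ⁻³(1 + a²(n+1)²/ℓ² + (n+1)R²/ℓ²) - Caρ_μ`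
(2.46), as the form inequality on symmetric **bounded** measurable `Φ` on `Λ(u)ⁿ`, additively in
`ℝ≥0∞` — verbatim `Fournais2020_eq243` with the extra hypothesis `∃ M, ∀ X, ‖Φ X‖ ≤ M`.
[cite: Fournais2020, (2.43)–(2.46), Lemma 2.3 (2.22)–(2.25), Lemma 2.4 (2.26)]
[cite: FournaisSolovej2020, Lemma B.2] -/
def Fournais2020_eq243_bdd : Prop :=
  ∀ (v : ℝ → ℝ≥0∞), IsRepulsiveFiniteRange v → (∫⁻ x : Space, v ‖x‖) ≠ ⊤ →
    0 < scatteringLength v →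
  ∀ (ω : Space → ℝ), IsScatteringSolution v ω →
  ∀ (χ : Space → ℝ), IsLocalizationFunction χ →
  ∀ (b s : ℝ), 0 < b → 0 < s →
  ∀ (R : ℝ), 0 < R → (∀ r, R < r → v r = 0) →
  ∃ C c₁ : ℝ, 0 < C ∧ 0 < c₁ ∧
    ∀ (ℓ ρμ : ℝ), 0 < ℓ → 0 < ρμ → R ≤ c₁ * ℓ →
      let a := (scatteringLength v).toReal
      ∀ (n : ℕ) (u : Space) (Φ : Config n → ℂ), Measurable Φ → (∃ M : ℝ, ∀ X, ‖Φ X‖ ≤ M) →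
        (∀ (σ : Equiv.Perm (Fin n)) (X : Config n), Φ (X ∘ σ) = Φ X) →
        (∫⁻ X in boxConfig n ℓ u, attrBoxN v ω χ ℓ ρμ u X * (‖Φ X‖₊ : ℝ≥0∞) ^ 2) +
            ENNReal.ofReal (2 * Real.pi * (a / ℓ ^ 3) * (ρμ * ℓ ^ 3 - n) ^ 2) *
              (∫⁻ X in boxConfig n ℓ u, (‖Φ X‖₊ : ℝ≥0∞) ^ 2) +
            ENNReal.ofReal (b / ℓ ^ 2) * nPlusBoxN ℓ u Φ ≤
          kinBoxN χ ℓ s b u Φ +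
            (∫⁻ X in boxConfig n ℓ u, repBoxN v χ ℓ u X * (‖Φ X‖₊ : ℝ≥0∞) ^ 2) +
            ENNReal.ofReal (C * a * ((n + 1) / ℓ ^ 3 + ρμ)) * nPlusBoxN ℓ u Φ +
            ENNReal.ofReal (4 * Real.pi * a * ρμ ^ 2 * ℓ ^ 3 +
                C * n * a / ℓ ^ 3 * (1 + a ^ 2 * (n + 1) ^ 2 / ℓ ^ 2 + (n + 1) * R ^ 2 / ℓ ^ 2) +
                C * a * ρμ) *
              ∫⁻ X in boxConfig n ℓ u, (‖Φ X‖₊ : ℝ≥0∞) ^ 2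

/-- (2.43) for all states implies (2.43) on bounded states. [cite: Fournais2020, (2.43)–(2.46)] -/
theorem Fournais2020_eq243.bdd (h : Fournais2020_eq243) : Fournais2020_eq243_bdd := by
  intro v hv hvi ha ω hω χ hχ b s hb hs R hR0 hR
  obtain ⟨C, c₁, hC, hc₁, H⟩ := h v hv hvi ha ω hω χ hχ b s hb hs R hR0 hR
  refine ⟨C, c₁, hC, hc₁, fun ℓ ρμ hℓ hρμ hRℓ => ?_⟩
  intro a n u Φ hΦm _ hΦs
  exact H ℓ ρμ hℓ hρμ hRℓ n u Φ hΦm hΦs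

/-! ### Theorem 2.1 on bounded states -/

/-- **Fournais 2020, Theorem 2.1, on bounded states** ("actually the same as
[BrietzkeFournaisSolovej2020, Thm. 6.1]"). If `K` in `ℓ = K⁻¹(ρ_μa)^{-1/2}` (2.1) is large enough
there is `C₀ > 0` such that for `ρ_μa³` small enough `H_Λ(ρ_μ) ≥ -4πρ_μ²aℓ³ - C₀ρ_μ²aℓ³(ρ_μa³)^{1/2}`
(2.11), as the form inequality on every sector for symmetric **bounded** measurable `Φ` on `Λ(u)^M`,
additively in `ℝ≥0∞` — verbatim `Fournais2020_thm21` with the extra hypothesis `∃ M', ∀ X, ‖Φ X‖ ≤ M'`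
(the slices of periodic `C¹` states to which (3.17) applies it are bounded).
[cite: Fournais2020, Thm. 2.1 (2.11), (2.6)] [cite: BrietzkeFournaisSolovej2020, Thm. 6.1] -/
def Fournais2020_thm21_bdd : Prop :=
  ∀ (v : ℝ → ℝ≥0∞), IsRepulsiveFiniteRange v → (∫⁻ x : Space, v ‖x‖) ≠ ⊤ →
    0 < scatteringLength v →
  ∀ (ω : Space → ℝ), IsScatteringSolution v ω →
  ∀ (χ : Space → ℝ), IsLocalizationFunction χ →
  ∀ (b s : ℝ), 0 < b → 0 < s →
  ∃ K₀ : ℝ, 0 < K₀ ∧ ∀ K : ℝ, K₀ ≤ K →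
  ∃ C₀ c : ℝ, 0 < C₀ ∧ 0 < c ∧
    ∀ (ρμ : ℝ), 0 < ρμ →
      let a := (scatteringLength v).toReal
      let ℓ := boxLength K ρμ a
      ρμ * a ^ 3 ≤ c →
      ∀ (M : ℕ) (u : Space) (Φ : Config M → ℂ), Measurable Φ → (∃ M' : ℝ, ∀ X, ‖Φ X‖ ≤ M') →
        (∀ (σ : Equiv.Perm (Fin M)) (X : Config M), Φ (X ∘ σ) = Φ X) →
        (∫⁻ X in boxConfig M ℓ u, attrBoxN v ω χ ℓ ρμ u X * (‖Φ X‖₊ : ℝ≥0∞) ^ 2) ≤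
          kinBoxN χ ℓ s b u Φ +
            (∫⁻ X in boxConfig M ℓ u, repBoxN v χ ℓ u X * (‖Φ X‖₊ : ℝ≥0∞) ^ 2) +
            ENNReal.ofReal
                (4 * Real.pi * ρμ ^ 2 * a * ℓ ^ 3 * (1 + C₀ * (ρμ * a ^ 3) ^ (1 / 2 : ℝ))) *
              ∫⁻ X in boxConfig M ℓ u, (‖Φ X‖₊ : ℝ≥0∞) ^ 2

/-- Theorem 2.1 on all states implies Theorem 2.1 on bounded states. [cite: Fournais2020, Thm. 2.1 (2.11)] -/
theorem Fournais2020_thm21.bdd (h : Fournais2020_thm21) : Fournais2020_thm21_bdd := by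
  intro v hv hvi ha ω hω χ hχ b s hb hs
  obtain ⟨K₀, hK₀, H⟩ := h v hv hvi ha ω hω χ hχ b s hb hs
  refine ⟨K₀, hK₀, fun K hK => ?_⟩
  obtain ⟨C₀, c, hC₀, hc, H'⟩ := H K hK
  refine ⟨C₀, c, hC₀, hc, fun ρμ hρμ => ?_⟩
  intro a ℓ hρc M u Φ hΦm _ hΦs
  exact H' ρμ hρμ hρc M u Φ hΦm hΦs

end Literature.MathematicalPhysics.QuantumManyBody.BoseGas

end
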